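import Mathlib
import Literature.RingTheory.CohomologyAnnihilator.Basic
import Summits.ResolutionOfSingularities.ResolutionOfSingularities.Theorems.HomologicalConductorNoZenoBirthDefs
import Summits.ResolutionOfSingularities.ResolutionOfSingularities.Theorems.HomologicalConductorPersistenceNormalisedChartRegular
import Summits.ResolutionOfSingularities.ResolutionOfSingularities.Theorems.HomologicalConductorPersistenceLocalStep
import HarnessLib

/-!
# Core reduction for `Persistence`, in the route's named vocabulary (`NoZeno.Birth.ca / nrm / loc`)

Crux `HomologicalConductor.Persistence` (stmt-ResolutionOfSingularities-16484), chain W4.4b, plan of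
record `L/w44b/CHAIN.md` v0.1 §2.4 (typed signatures `PlanSignatures.lean`, sha16 d37bc50f31bc6049):
this file proves the two statements assigned to stub worker 2 with the planner's binders VERBATIM,
over `Theorems.NoZeno.Birth.{ca, nrm, loc}` (p165967) and the affine chart
`B[ca B / x] = Algebra.adjoin k (B ∪ {c * x⁻¹ | c ∈ ca B})` written inline:

* `H_a_reduction` — for any `k`-subalgebra `C ⊇ B[ca B / x]` and `x ∈ ca B`, `x ≠ 0`:
  `ca B ⊆ ca C ↔ x ∈ ca C` (reduction of persistence to ONE membership);
* `H_b_curveCase` — the curve case of the core stub: `ringKrullDim B ≤ 1 ⇒ ca B ⊆ ca (nrm (B[ca B / x]))`;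
* `R1_iff_mem_loc` — the planner's re-cut core `R1_localChartPersistence` (O-form) is likewise ONE
  membership: `ca B ⊆ ca (loc O (nrm (B[ca B / x]))) ↔ x ∈ ca (loc O (nrm (B[ca B / x])))`.

All three are transports, along the bridge `ca B = (↑) '' cohomologyAnnihilator ↥B`
(`ca_eq_image`, from `Subalgebra.image_coe_cohomologyAnnihilator`), of the lemmas landed in
`Theorems/HomologicalConductorPersistenceNormalisedChartRegular.lean` (p458744). `[OURS · L1 w44b]`;
folklore bookkeeping, not statements of any manuscript.

References: S. B. Iyengar, R. Takahashi, *Annihilation of cohomology and strong generation of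
module categories*, IMRN 2016 [`IyengarTakahashi2014`], Def. 2.1, Example 2.5.
-/

-- single-problem summit: the doubled namespace component is forced
set_option linter.dupNamespace false

noncomputable section

namespace Summit.ResolutionOfSingularities.ResolutionOfSingularities.Theorems.HomologicalConductor.PersistenceCoreReduction

open Summit.ResolutionOfSingularities.ResolutionOfSingularities.Theorems.NoZeno.Birth (ca nrm loc)
open Summit.ResolutionOfSingularities.ResolutionOfSingularities.Theorems.HomologicalConductor.PersistenceNormalisedChartRegular
  (image_subset_image_of_mem stub_normalisedChartPersistence_of_ringKrullDim_le_one)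

variable {k K : Type} [Field k] [Field K] [Algebra k K]

/-- **Bridge.** The route's inline annihilator set `ca B ⊆ K` is the image of the Literature ideal
`cohomologyAnnihilator ↥B` (`Subalgebra.image_coe_cohomologyAnnihilator`, universe `0`).
[cite: IyengarTakahashi2014, Def. 2.1] -/
theorem ca_eq_image (B : Subalgebra k K) :
    ca B = ((↑) : ↥B → K) ''
      (Literature.RingTheory.CohomologyAnnihilator.cohomologyAnnihilator ↥B : Set ↥B) :=
  (Subalgebra.image_coe_cohomologyAnnihilator B).symm

/-- **H-a (CHAIN.md v0.1 §2.4, stub-2) — reduction to one membership.** For any `k`-subalgebra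
`C ⊇ B[ca B / x]` (e.g. `nrm (B[ca B / x])` or `loc O (nrm (B[ca B / x]))`) and `x ∈ ca B`,
`x ≠ 0`: `ca B ⊆ ca C ↔ x ∈ ca C`. (`→`: specialise at `x`; `←`: `c = (c x⁻¹) · x` with
`c x⁻¹ ∈ C` and `ca C` an ideal — landed `image_subset_image_of_mem`.)
[cite: IyengarTakahashi2014, Def. 2.1] -/
theorem H_a_reduction (B C : Subalgebra k K) (x : K) (hx : x ∈ ca B) (hx0 : x ≠ 0)
    (hC : Algebra.adjoin k ((B : Set K) ∪ {y : K | ∃ c ∈ ca B, y = c * x⁻¹}) ≤ C) :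
    ca B ⊆ ca C ↔ x ∈ ca C := by
  refine ⟨fun h => h hx, fun h => ?_⟩
  rw [ca_eq_image] at h ⊢
  rw [ca_eq_image C]
  refine image_subset_image_of_mem B C hx0 (fun c hc => hC ?_) h
  rw [← ca_eq_image] at hc
  exact Algebra.subset_adjoin (Or.inr ⟨c, hc, rfl⟩)

/-- **H-b (CHAIN.md v0.1 §2.4, stub-2) — curve case of the core stub.** If `dim B ≤ 1`
(`B ⊆ K` essentially of finite type over `k`, `Frac B = K`) and `x ∈ ca B`, `x ≠ 0`, then
`ca B ⊆ ca (nrm (B[ca B / x]))`: the normalised chart is a Dedekind domain (Krull–Akizuki), hence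
regular, so its `ca` is everything — landed `stub_normalisedChartPersistence_of_ringKrullDim_le_one`
transported along `ca_eq_image`. (`IsLocalRing B` is carried for signature fidelity; unused.)
[cite: IyengarTakahashi2014, Example 2.5] -/
theorem H_b_curveCase (B : Subalgebra k K) (x : K) (hBft : Algebra.EssFiniteType k ↥B)
    (hBfrac : IsFractionRing ↥B K) (hBloc : IsLocalRing ↥B) (hdim : ringKrullDim ↥B ≤ 1)
    (hx : x ∈ ca B) (hx0 : x ≠ 0) :
    ca B ⊆ ca (nrm (Algebra.adjoin k ((B : Set K) ∪ {y : K | ∃ c ∈ ca B, y = c * x⁻¹}))) := by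
  rw [ca_eq_image] at hx
  simp only [ca_eq_image]
  exact stub_normalisedChartPersistence_of_ringKrullDim_le_one k K B x hBft hBfrac hBloc hdim hx hx0

/-- **R1 is one membership too.** The planner's re-cut core (O-form, `R1_localChartPersistence`):
`ca B ⊆ ca (loc O (nrm (B[ca B / x])))` is equivalent, for `x ∈ ca B`, `x ≠ 0`, to the single
LOCAL membership `x ∈ ca (loc O (nrm (B[ca B / x])))` (`H_a_reduction` with
`C = loc O (nrm (B[ca B / x])) ⊇ B[ca B / x]`). [cite: IyengarTakahashi2014, Def. 2.1] -/
theorem R1_iff_mem_loc (O : ValuationSubring K) (B : Subalgebra k K) (x : K) (hx : x ∈ ca B)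
    (hx0 : x ≠ 0) :
    ca B ⊆ ca (loc O (nrm (Algebra.adjoin k ((B : Set K) ∪
        {y : K | ∃ c ∈ ca B, y = c * x⁻¹})))) ↔
      x ∈ ca (loc O (nrm (Algebra.adjoin k ((B : Set K) ∪
        {y : K | ∃ c ∈ ca B, y = c * x⁻¹})))) := by
  refine H_a_reduction B _ x hx hx0 fun y hy => ?_
  exact SyzygyFlattening.self_le_locAt O _ (SyzygyFlattening.self_le_nrm _ hy)

end Summit.ResolutionOfSingularities.ResolutionOfSingularities.Theorems.HomologicalConductor.PersistenceCoreReduction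

end
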